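import Summits.CriticalPhenomena.PercolationContinuityZ3.Theorems.PercNearOneGluingNoHeavyLowerTailSahiE3ExchangeNestedTrace
import Mathlib.Tactic.Linarith
import Mathlib.Tactic.Ring
import Mathlib.Tactic.Positivity
import HarnessLib
import HarnessLib.Audit

/-!
# `NoHeavyLowerTail` (crux stmt-CriticalPhenomena-4575), Sahi programme P4: the 2×2 exchange lemma — the antisymmetric-trace class (both sides trace-incomparable) via the hats packing

Support file (cell `prim-l12`, seat P4, generation 23; `--supports stmt-CriticalPhenomena-4575`).  No named facts, no sorries;
standard axioms; def-free.

Context (HOME prim-l12-p4/FROM-prim-l12-p4-gen23-*.md).  The 2×2 exchange lemma of the OR-peel (`…SahiE3ExchangeCross`,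
`…SahiE3ExchangeSubpairs`) for a Harris block `(B, w, V)` (`v = w(V)`, `a = w(· ∩ V)`,
`need(X,Y) = w(X)a(Y) + w(Y)a(X) − v·w(X)w(Y)`), a pair-certificate `R ≥ 0` on `V` and a configuration of up-sets
`O ⊆ K∩L`, `K∪L ⊆ P`, `O' ⊆ K'∩L'`, `K'∪L' ⊆ P'` reads
  `X_a + R(KK'V) + R(LL'V) − need(K,L') − need(L,K') + (1−v)·Y ≥ 0`,
`X_a = w(PP'V) + w(OO'V) − w(P)w(O'V) − w(P')w(OV)`, with the bracket `Y` of type 2 or 1.  The tree covers the crossing-free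
case, the empty-layer classes, one-side-nested sets or TRACES with a slot-null corner, and principal slots; the open core of the
programme was "both sides trace-incomparable".  THIS FILE proves the first such class, for EVERY corner class and every bracket
`Y ≥ 0`: the ANTISYMMETRIC-TRACE configurations
  `K' ∩ V = L ∩ V =: T`,  `L' ∩ V = K ∩ V =: S`
(both crossing cells are then the whole trace differences `S∖T`, `T∖S`).  The packing is the SAME-FOOTPRINT "hats" packing: any
sets `HS ⊇ K, L'` and `HT ⊇ L, K'` with traces `S`, `T` that are Harris-positive against the slot (`v·w(HS) ≤ w(HS∩V)`, e.g.
the V-saturations `sat_V(S)`, `sat_V(T)`, which are up-sets); the footprints `HS∩HT∩V = K∩K'∩V = L∩L'∩V` are exactly the two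
supplies.  The R-free residual closes by the chain (`κ̂_S = a_S − v·w(HS) ≥ 0`, `a_S = w(S)`)
  `v·[need(HS,HT) + need(HT,HS) − need(K,L') − need(L,K')] ≥ (κ̂_S − κ̂_T)² − (a_S − a_T)²`,
  `X_a ≥ w(S △ T) ≥ |a_S − a_T|` (modularity over the nested differences plus the two Harris slacks of `X_a`; every point of
  `S △ T` lies in `(P∖O) ∩ (P'∖O') ∩ V` by the trace identities) and `|a_S − a_T| ≤ v`,
so `v·(exchange expression) ≥ v·|a_S−a_T| − (a_S−a_T)² ≥ 0` (`exchange_antisym`; scalar core `antisym_scalar`).  For the flagship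
block `x₀∧(x₁∨x₂)` this is the whole class-I/II/I∩II crossing family at level `G' = ∅` (HOME memo); numerically the class has
0 failures on every block tested (n = 3 exhaustive, n = 4 sampled).
-/

namespace Summit.CriticalPhenomena.PercolationContinuityZ3.Theorems.SahiE3ExchangeAntisym

open Finset SahiE3DimerPacking SahiE3ExchangeCross SahiE3ExchangeNestedTrace
open scoped BigOperators

variable {B : Type*} [DecidableEq B]

/-- **Scalar core of the antisymmetric-trace class.**  Reals: slot mass `v ∈ [0,1]`, trace masses `aS, aT ∈ [0,v]`, raw masses
`k, l' ≤ hS` and `l, k' ≤ hT` below the hat masses, hats Harris-positive (`v·hS ≤ aS`, `v·hT ≤ aT`), supplies `RK, RL` above the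
hat needs `hS·aT + hT·aS − v·hS·hT`, a base `X ≥ |aS − aT|` and a bracket `Y ≥ 0`.  Then
`X + RK + RL − (k·aS + l'·aS − v·k·l') − (l·aT + k'·aT − v·l·k') + (1−v)·Y ≥ 0`. [this work] -/
theorem antisym_scalar (v aS aT k l k' l' hS hT X Y RK RL : ℝ)
    (hv0 : 0 ≤ v) (hv1 : v ≤ 1) (haS0 : 0 ≤ aS) (haT0 : 0 ≤ aT) (haSv : aS ≤ v) (haTv : aT ≤ v)
    (hk : k ≤ hS) (hl' : l' ≤ hS) (hl : l ≤ hT) (hk' : k' ≤ hT)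
    (hκS : v * hS ≤ aS) (hκT : v * hT ≤ aT)
    (hX₁ : aS - aT ≤ X) (hX₂ : aT - aS ≤ X) (hY : 0 ≤ Y)
    (hRK : hS * aT + hT * aS - v * hS * hT ≤ RK) (hRL : hT * aS + hS * aT - v * hT * hS ≤ RL) :
    0 ≤ X + RK + RL - (k * aS + l' * aS - v * k * l') - (l * aT + k' * aT - v * l * k') + (1 - v) * Y := by
  -- the raw κ's dominate the hat κ̂'s, which are nonnegative
  have e1 : (aS - v * hS) * (aS - v * hS) ≤ (aS - v * k) * (aS - v * l') := by
    have h1 : aS - v * hS ≤ aS - v * k := by nlinarith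
    have h2 : aS - v * hS ≤ aS - v * l' := by nlinarith
    have h0 : 0 ≤ aS - v * hS := by linarith
    calc (aS - v * hS) * (aS - v * hS) ≤ (aS - v * k) * (aS - v * hS) :=
          mul_le_mul_of_nonneg_right h1 h0
      _ ≤ (aS - v * k) * (aS - v * l') := mul_le_mul_of_nonneg_left h2 (by linarith)
  have e2 : (aT - v * hT) * (aT - v * hT) ≤ (aT - v * l) * (aT - v * k') := by
    have h1 : aT - v * hT ≤ aT - v * l := by nlinarith
    have h2 : aT - v * hT ≤ aT - v * k' := by nlinarith
    have h0 : 0 ≤ aT - v * hT := by linarith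
    calc (aT - v * hT) * (aT - v * hT) ≤ (aT - v * l) * (aT - v * hT) :=
          mul_le_mul_of_nonneg_right h1 h0
      _ ≤ (aT - v * l) * (aT - v * k') := mul_le_mul_of_nonneg_left h2 (by linarith)
  -- v·(supplies − needs) ≥ (κ̂S − κ̂T)² − (aS − aT)²  (polarisation of the Minkowski form a·a' − κ·κ')
  have core : (aS - v * hS - (aT - v * hT)) ^ 2 - (aS - aT) ^ 2
      ≤ v * (RK + RL - (k * aS + l' * aS - v * k * l') - (l * aT + k' * aT - v * l * k')) := by
    nlinarith [hRK, hRL, e1, e2]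
  -- v·X ≥ (aS − aT)²  since |aS − aT| ≤ v
  have base : (aS - aT) ^ 2 ≤ v * X := by
    rcases le_total aS aT with h | h
    · nlinarith [mul_le_mul_of_nonneg_left hX₂ hv0]
    · nlinarith [mul_le_mul_of_nonneg_left hX₁ hv0]
  have sq : 0 ≤ (aS - v * hS - (aT - v * hT)) ^ 2 := sq_nonneg _
  have hvY : 0 ≤ (1 - v) * Y := mul_nonneg (by linarith) hY
  -- conclude: v·(expression) ≥ 0, and the case v = 0 directly
  rcases eq_or_lt_of_le hv0 with hv | hv
  · -- v = 0 forces aS = aT = 0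
    have haS : aS = 0 := by rw [← hv] at haSv; linarith
    have haT : aT = 0 := by rw [← hv] at haTv; linarith
    subst haS; subst haT
    rw [← hv] at hRK hRL ⊢
    nlinarith [hRK, hRL, hX₁]
  · have key : 0 ≤ v * (X + RK + RL - (k * aS + l' * aS - v * k * l') - (l * aT + k' * aT - v * l * k')) := by
      nlinarith [core, base, sq]
    have key2 : 0 ≤ X + RK + RL - (k * aS + l' * aS - v * k * l') - (l * aT + k' * aT - v * l * k') := by
      by_contra hneg
      have hneg : X + RK + RL - (k * aS + l' * aS - v * k * l') - (l * aT + k' * aT - v * l * k') < 0 :=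
        lt_of_not_ge hneg
      have : v * (X + RK + RL - (k * aS + l' * aS - v * k * l') - (l * aT + k' * aT - v * l * k')) < 0 :=
        mul_neg_of_pos_of_neg hv hneg
      linarith
    linarith

/-- The symmetric difference dominates the difference of traces (pointwise `1_{K△L} ≥ 1_K − 1_L` on `V`), for `w ≥ 0` on `V`.
[folklore] -/
theorem sum_symmDiff_ge_diff (w : B → ℝ) (V K L : Finset B) (hw : ∀ b ∈ V, 0 ≤ w b) :
    (∑ b ∈ K ∩ V, w b) - ∑ b ∈ L ∩ V, w b ≤ ∑ b ∈ ((K \ L) ∪ (L \ K)) ∩ V, w b := by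
  rw [sub_le_iff_le_add]
  simp only [sum_inter_eq_sum_ite, ← Finset.sum_add_distrib]
  refine Finset.sum_le_sum fun b hb => ?_
  have hwb := hw b hb
  by_cases hk : b ∈ K <;> by_cases hl : b ∈ L <;>
    simp [hk, hl, Finset.mem_union, Finset.mem_sdiff, hwb]

/-- **Base term of the antisymmetric class.**  For `w ≥ 0` on `V`, a configuration `O ⊆ K∩L`, `K∪L ⊆ P`, `O' ⊆ K'∩L'`,
`K'∪L' ⊆ P'` with antisymmetric traces `K'∩V = L∩V`, `L'∩V = K∩V`, every point of `(K △ L) ∩ V` lies in `P ∩ P'` and outside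
`O ∪ O'`, whence `w(PP'V) + w(OO'V) ≥ w(PO'V) + w(OP'V) + w((K△L)∩V)` (pointwise `(1_P − 1_O)(1_{P'} − 1_{O'}) ≥ 1_{K△L}` on `V`).
[this work] -/
theorem modularity_antisym (w : B → ℝ) (V K L P O K' L' P' O' : Finset B) (hw : ∀ b ∈ V, 0 ≤ w b)
    (hKP : K ⊆ P) (hLP : L ⊆ P) (hOK : O ⊆ K) (hOL : O ⊆ L)
    (hKP' : K' ⊆ P') (hLP' : L' ⊆ P') (hOK' : O' ⊆ K') (hOL' : O' ⊆ L')
    (hTK' : K' ∩ V = L ∩ V) (hTL' : L' ∩ V = K ∩ V) :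
    (∑ b ∈ (P ∩ O') ∩ V, w b) + (∑ b ∈ (O ∩ P') ∩ V, w b) + ∑ b ∈ ((K \ L) ∪ (L \ K)) ∩ V, w b
      ≤ (∑ b ∈ (P ∩ P') ∩ V, w b) + ∑ b ∈ (O ∩ O') ∩ V, w b := by
  simp only [sum_inter_eq_sum_ite, ← Finset.sum_add_distrib]
  refine Finset.sum_le_sum fun b hb => ?_
  have hwb := hw b hb
  -- a point of the symmetric difference (inside V) lies in P ∩ P' and outside O ∪ O'
  have key : b ∈ (K \ L) ∪ (L \ K) → (b ∈ P ∧ b ∈ P' ∧ b ∉ O ∧ b ∉ O') := by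
    intro h
    rcases Finset.mem_union.1 h with h1 | h1
    · obtain ⟨hbK, hbL⟩ := Finset.mem_sdiff.1 h1
      have hbL' : b ∈ L' := by
        have : b ∈ L' ∩ V := by rw [hTL']; exact Finset.mem_inter.2 ⟨hbK, hb⟩
        exact (Finset.mem_inter.1 this).1
      have hbK' : b ∉ K' := by
        intro h'
        have : b ∈ K' ∩ V := Finset.mem_inter.2 ⟨h', hb⟩
        rw [hTK'] at this
        exact hbL (Finset.mem_inter.1 this).1
      exact ⟨hKP hbK, hLP' hbL', fun h' => hbL (hOL h'), fun h' => hbK' (hOK' h')⟩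
    · obtain ⟨hbL, hbK⟩ := Finset.mem_sdiff.1 h1
      have hbK' : b ∈ K' := by
        have : b ∈ K' ∩ V := by rw [hTK']; exact Finset.mem_inter.2 ⟨hbL, hb⟩
        exact (Finset.mem_inter.1 this).1
      have hbL' : b ∉ L' := by
        intro h'
        have : b ∈ L' ∩ V := Finset.mem_inter.2 ⟨h', hb⟩
        rw [hTL'] at this
        exact hbK (Finset.mem_inter.1 this).1
      exact ⟨hLP hbL, hKP' hbK', fun h' => hbK (hOK h'), fun h' => hbL' (hOL' h')⟩
  by_cases hd : b ∈ (K \ L) ∪ (L \ K)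
  · obtain ⟨hp, hp', ho, ho'⟩ := key hd
    simp [hd, hp, hp', ho, ho', Finset.mem_inter]
  · have hOP : O ⊆ P := hOK.trans hKP
    have hOP' : O' ⊆ P' := hOK'.trans hKP'
    by_cases hp : b ∈ P <;> by_cases ho : b ∈ O <;> by_cases hp' : b ∈ P' <;> by_cases ho' : b ∈ O' <;>
      simp only [hd, hp, ho, hp', ho', Finset.mem_inter, and_true, and_false, and_self,
        ↓reduceIte, add_zero, zero_add, le_refl] <;>
      first
        | exact absurd (hOP ho) hp
        | exact absurd (hOP' ho') hp'
        | linarith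

/-- **The 2×2 exchange lemma, antisymmetric-trace class (both sides trace-incomparable), any bracket `Y ≥ 0`.**  `B` finite,
`w ≥ 0` of total mass `1`, `V ⊆ B` the slot; a configuration `O ⊆ K, L ⊆ P`, `O' ⊆ K', L' ⊆ P'` whose traces are swapped across
the two sides, `K' ∩ V = L ∩ V` and `L' ∩ V = K ∩ V`; "hat" sets `HS ⊇ K, L'` and `HT ⊇ L, K'` with the same traces
(`HS ∩ V = K ∩ V`, `HT ∩ V = L ∩ V`) that are Harris-positive against the slot (`v·w(HS) ≤ w(HS∩V)`, `v·w(HT) ≤ w(HT∩V)` —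
e.g. the V-saturations, which are up-sets); a weight `R` satisfying the pair inequality at `(HS,HT)` and `(HT,HS)` (footprint
`HS ∩ HT ∩ V = K ∩ K' ∩ V = L ∩ L' ∩ V`); Harris for `(P, O'∩V)` and `(P', O∩V)`.  Then
`w(PP'V) + w(OO'V) − w(P)w(O'V) − w(P')w(OV) + R(KK'V) + R(LL'V) − need(K,L') − need(L,K') + (1−v)·Y ≥ 0`
— in particular for the type-2 bracket `Y = Har(P,P') + (p−k)(p'−l') + (p−l)(p'−k')` and the type-1 bracket
`Y = Har(P,P') + (p−k)(k'−o') + (p−o)(p'−k')` of the OR-peel, both nonnegative under the nestings. [this work] -/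
theorem exchange_antisym [Fintype B] (w R : B → ℝ) (hw : ∀ b, 0 ≤ w b) (hw1 : ∑ b, w b = 1)
    (V K L P O K' L' P' O' HS HT : Finset B) (Y : ℝ)
    (hKP : K ⊆ P) (hLP : L ⊆ P) (hOK : O ⊆ K) (hOL : O ⊆ L)
    (hKP' : K' ⊆ P') (hLP' : L' ⊆ P') (hOK' : O' ⊆ K') (hOL' : O' ⊆ L')
    (hTK' : K' ∩ V = L ∩ V) (hTL' : L' ∩ V = K ∩ V)
    (hKS : K ⊆ HS) (hL'S : L' ⊆ HS) (hLT : L ⊆ HT) (hK'T : K' ⊆ HT)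
    (hTS : HS ∩ V = K ∩ V) (hTT : HT ∩ V = L ∩ V)
    (hHarS : (∑ b ∈ V, w b) * (∑ b ∈ HS, w b) ≤ ∑ b ∈ HS ∩ V, w b)
    (hHarT : (∑ b ∈ V, w b) * (∑ b ∈ HT, w b) ≤ ∑ b ∈ HT ∩ V, w b)
    (hpair₁ : (∑ b ∈ HS, w b) * (∑ b ∈ HT ∩ V, w b) + (∑ b ∈ HT, w b) * (∑ b ∈ HS ∩ V, w b)
        - (∑ b ∈ V, w b) * (∑ b ∈ HS, w b) * (∑ b ∈ HT, w b) ≤ ∑ b ∈ (K ∩ K') ∩ V, R b)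
    (hpair₂ : (∑ b ∈ HT, w b) * (∑ b ∈ HS ∩ V, w b) + (∑ b ∈ HS, w b) * (∑ b ∈ HT ∩ V, w b)
        - (∑ b ∈ V, w b) * (∑ b ∈ HT, w b) * (∑ b ∈ HS, w b) ≤ ∑ b ∈ (L ∩ L') ∩ V, R b)
    (hHar₁ : (∑ b ∈ P, w b) * (∑ b ∈ O' ∩ V, w b) ≤ ∑ b ∈ (P ∩ O') ∩ V, w b)
    (hHar₂ : (∑ b ∈ P', w b) * (∑ b ∈ O ∩ V, w b) ≤ ∑ b ∈ (O ∩ P') ∩ V, w b)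
    (hY : 0 ≤ Y) :
    0 ≤ (∑ b ∈ (P ∩ P') ∩ V, w b) + (∑ b ∈ (O ∩ O') ∩ V, w b)
        - (∑ b ∈ P, w b) * (∑ b ∈ O' ∩ V, w b) - (∑ b ∈ P', w b) * (∑ b ∈ O ∩ V, w b)
        + (∑ b ∈ (K ∩ K') ∩ V, R b) + (∑ b ∈ (L ∩ L') ∩ V, R b)
        - ((∑ b ∈ K, w b) * (∑ b ∈ L' ∩ V, w b) + (∑ b ∈ L', w b) * (∑ b ∈ K ∩ V, w b)
            - (∑ b ∈ V, w b) * (∑ b ∈ K, w b) * (∑ b ∈ L', w b))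
        - ((∑ b ∈ L, w b) * (∑ b ∈ K' ∩ V, w b) + (∑ b ∈ K', w b) * (∑ b ∈ L ∩ V, w b)
            - (∑ b ∈ V, w b) * (∑ b ∈ L, w b) * (∑ b ∈ K', w b))
        + (1 - ∑ b ∈ V, w b) * Y := by
  have hwV : ∀ b ∈ V, 0 ≤ w b := fun b _ => hw b
  -- base: modularity + the two Harris slacks give X_a ≥ w((K△L) ∩ V) ≥ |aS − aT|
  have hmod := modularity_antisym w V K L P O K' L' P' O' hwV hKP hLP hOK hOL hKP' hLP' hOK' hOL' hTK' hTL'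
  have hd₁ := sum_symmDiff_ge_diff w V K L hwV
  have hd₂ := sum_symmDiff_ge_diff w V L K hwV
  have hDsym : ((L \ K) ∪ (K \ L)) ∩ V = ((K \ L) ∪ (L \ K)) ∩ V := by rw [Finset.union_comm]
  rw [hDsym] at hd₂
  -- masses
  have hv1 : ∑ b ∈ V, w b ≤ 1 := by
    rw [← hw1]; exact sum_le_sum_of_subset' w hw (Finset.subset_univ V)
  have hv0 : 0 ≤ ∑ b ∈ V, w b := Finset.sum_nonneg fun b _ => hw b
  have hk : ∑ b ∈ K, w b ≤ ∑ b ∈ HS, w b := sum_le_sum_of_subset' w hw hKS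
  have hl' : ∑ b ∈ L', w b ≤ ∑ b ∈ HS, w b := sum_le_sum_of_subset' w hw hL'S
  have hl : ∑ b ∈ L, w b ≤ ∑ b ∈ HT, w b := sum_le_sum_of_subset' w hw hLT
  have hk' : ∑ b ∈ K', w b ≤ ∑ b ∈ HT, w b := sum_le_sum_of_subset' w hw hK'T
  have haS0 : 0 ≤ ∑ b ∈ K ∩ V, w b := Finset.sum_nonneg fun b _ => hw b
  have haT0 : 0 ≤ ∑ b ∈ L ∩ V, w b := Finset.sum_nonneg fun b _ => hw b
  have haSv : ∑ b ∈ K ∩ V, w b ≤ ∑ b ∈ V, w b := sum_le_sum_of_subset' w hw Finset.inter_subset_right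
  have haTv : ∑ b ∈ L ∩ V, w b ≤ ∑ b ∈ V, w b := sum_le_sum_of_subset' w hw Finset.inter_subset_right
  -- trace identities
  rw [hTS, hTT] at hpair₁ hpair₂
  rw [hTS] at hHarS
  rw [hTT] at hHarT
  rw [hTK', hTL']
  exact le_trans (antisym_scalar (∑ b ∈ V, w b) (∑ b ∈ K ∩ V, w b) (∑ b ∈ L ∩ V, w b)
      (∑ b ∈ K, w b) (∑ b ∈ L, w b) (∑ b ∈ K', w b) (∑ b ∈ L', w b) (∑ b ∈ HS, w b) (∑ b ∈ HT, w b)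
      ((∑ b ∈ (P ∩ P') ∩ V, w b) + (∑ b ∈ (O ∩ O') ∩ V, w b)
        - (∑ b ∈ P, w b) * (∑ b ∈ O' ∩ V, w b) - (∑ b ∈ P', w b) * (∑ b ∈ O ∩ V, w b))
      Y (∑ b ∈ (K ∩ K') ∩ V, R b) (∑ b ∈ (L ∩ L') ∩ V, R b)
      hv0 hv1 haS0 haT0 haSv haTv hk hl' hl hk' hHarS hHarT
      (by linarith) (by linarith) hY hpair₁ hpair₂) (le_of_eq (by ring))

end Summit.CriticalPhenomena.PercolationContinuityZ3.Theorems.SahiE3ExchangeAntisym
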